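import Literature.Probability.FitznerVanDerHofstad2017.SrwLawBesselEGF
import HarnessLib

/-!
# Twisted walk counts with a DIFFERENT row in each coordinate: the EGF is `∏_i (Σ_a c_i(a) I_a(2s))`

Family version of `SrwTwistedCountEGF.lean` (`hasSum_twistedCount_egf`: one coefficient row `c` in all
`d` coordinates, EGF `(Σ_{a∈S} c(a) I_a(2s))^d`).  The WEIGHTED twisted moments of the K/U atoms
(weights `|D̂|^l`, `|D̂|^l D̂^{sin}`, `M̂²`-insertions: polynomials in the coordinate cosines) are, under
the product structure of the `u`-representation [FitznerVanDerHofstad2016NoBLE, §5.1.1 (5.2)–(5.5)],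
sums of products `∏_i Φ_i(v)` whose factors are one-coordinate transforms with INSERTED cosine powers —
each again a finite Bessel combination `Φ_i(v) = Σ_{a ∈ S_i} c_i(a) I_a(v)`, but no longer the same
in every coordinate.  The Poisson-block semantics of a kernel certificate for such a product is:

* `hasSum_twistedCount_egf_family` — **`Σ_m t_m sᵐ/m! = ∏_i (Σ_{a ∈ S_i} c_i(a) I_a(2s))`** with the
  twisted counts `t_m = Σ_{x ∈ ∏_i S_i} (∏_i c_i(x_i)) · srwCount d m x` (every `d`, all finite
  `S_i ⊂ ℤ`, all `c_i : ℤ → ℂ`, every real `s`); `hasSum_twistedCount_egf_family_half` — at `s = v/2`;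
* `norm_twistedCount_family_le` — `‖t_m‖ ≤ (∏_i C_i) (2d)^m` when `‖c_i(a)‖ ≤ C_i` on `S_i`
  (the plain block's `N`-remainder up to the constant `∏_i C_i`).

Everything is PROVED (standard axioms), `d`-generic and table-free; no definition, no named fact.
Epistemic status / lane: what-if / input-certification SUPPORT (semantics of the Poisson block of a
twisted-seed kernel certificate with coordinate-dependent rows); nothing here is a certificate and no
statement at a specific dimension is made.

## References
* R. Fitzner, R. van der Hofstad, PTRF 169 (2017) 1041–1119, §5.1.1 (5.3)–(5.5) pp. 1089–1090.
  [FitznerVanDerHofstad2016NoBLE]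
* T. Hara, G. Slade, Rev. Math. Phys. 4 (1992) 235–327, App. B. [HaraSlade1992b]
* NIST DLMF §10.25.2, §10.35. [DLMF]
-/

noncomputable section

open Finset
open scoped Nat

namespace Literature.Probability.FitznerVanDerHofstad2017

open Literature.Probability.LatticeModels (besselI)
open SrwCount (srwCount srwLaw_eq_srwCount_div)
open Literature.Barriers.CriticalPhenomena.LongRangePhi4 (srwLaw hasSum_srwLaw srwLaw_nonneg)

variable {d : ℕ}

/-- **EGF of the twisted walk counts, one row per coordinate.** For finite `S_i ⊂ ℤ`,
`c_i : ℤ → ℂ` (`i : Fin d`) and real `s`,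
`Σ_m (Σ_{x ∈ ∏_i S_i} (∏_i c_i(x_i)) srwCount d m x) sᵐ/m! = ∏_i (Σ_{a ∈ S_i} c_i(a) I_a(2s))`
(expand the product over `∏_i S_i` and use `Σ_m srwCount d m x sᵐ/m! = ∏_i I_{x_i}(2s)`).
[cite: FitznerVanDerHofstad2016NoBLE, §5.1.1 (5.3)–(5.5) pp. 1089–1090] -/
theorem hasSum_twistedCount_egf_family (S : Fin d → Finset ℤ) (c : Fin d → ℤ → ℂ) (s : ℝ) :
    HasSum (fun m : ℕ => (∑ x ∈ Fintype.piFinset S,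
        (∏ i, c i (x i)) * (srwCount d m x : ℂ)) * ((s : ℂ) ^ m / (m ! : ℂ)))
      (∏ i, ∑ a ∈ S i, c i a * (besselI a (2 * s) : ℂ)) := by
  have hx : ∀ x : Fin d → ℤ, HasSum (fun m : ℕ => (∏ i, c i (x i))
      * ((srwCount d m x : ℂ) * ((s : ℂ) ^ m / (m ! : ℂ))))
      ((∏ i, c i (x i)) * (∏ i, (besselI (x i) (2 * s) : ℂ))) := by
    intro x
    have h := Complex.ofRealCLM.hasSum (hasSum_srwCount_egf x s)
    simp only [Complex.ofRealCLM_apply] at h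
    push_cast at h
    refine (h.mul_left (∏ i, c i (x i))).congr_fun fun m => ?_
    ring
  have hsum := hasSum_sum (s := Fintype.piFinset S) (fun x _ => hx x)
  have hval : (∑ x ∈ Fintype.piFinset S,
      (∏ i, c i (x i)) * (∏ i, (besselI (x i) (2 * s) : ℂ)))
      = ∏ i, ∑ a ∈ S i, c i a * (besselI a (2 * s) : ℂ) := by
    rw [Finset.prod_univ_sum S (fun i a => c i a * (besselI a (2 * s) : ℂ))]
    refine Finset.sum_congr rfl fun x _ => ?_
    rw [Finset.prod_mul_distrib]
  rw [hval] at hsum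
  refine hsum.congr_fun fun m => ?_
  rw [Finset.sum_mul]
  refine Finset.sum_congr rfl fun x _ => ?_
  ring

/-- The same at `s = v/2`: `Σ_m t_m (v/2)ᵐ/m! = ∏_i (Σ_{a ∈ S_i} c_i(a) I_a(v))`.
[cite: FitznerVanDerHofstad2016NoBLE, §5.1.1 (5.3)–(5.5) pp. 1089–1090] -/
theorem hasSum_twistedCount_egf_family_half (S : Fin d → Finset ℤ) (c : Fin d → ℤ → ℂ) (v : ℝ) :
    HasSum (fun m : ℕ => (∑ x ∈ Fintype.piFinset S,
        (∏ i, c i (x i)) * (srwCount d m x : ℂ)) * ((((v / 2 : ℝ)) : ℂ) ^ m / (m ! : ℂ)))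
      (∏ i, ∑ a ∈ S i, c i a * (besselI a v : ℂ)) := by
  have h := hasSum_twistedCount_egf_family (d := d) S c (v / 2)
  rw [show 2 * (v / 2) = v by ring] at h
  exact h

/-- **Size of the twisted counts**: if `0 ≤ C_i` and `‖c_i(a)‖ ≤ C_i` on `S_i` then
`‖t_m‖ ≤ (∏_i C_i)(2d)^m` for `1 ≤ d` (`Σ_x srwCount d m x ≤ (2d)^m`).
[cite: FitznerVanDerHofstad2016NoBLE, §5.1.1 (5.4)–(5.5) pp. 1089–1090] -/
theorem norm_twistedCount_family_le (hd : 1 ≤ d) {S : Fin d → Finset ℤ} {c : Fin d → ℤ → ℂ}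
    {C : Fin d → ℝ} (hC : ∀ i, 0 ≤ C i) (hc : ∀ i, ∀ a ∈ S i, ‖c i a‖ ≤ C i) (m : ℕ) :
    ‖∑ x ∈ Fintype.piFinset S, (∏ i, c i (x i)) * (srwCount d m x : ℂ)‖
      ≤ (∏ i, C i) * (2 * d : ℝ) ^ m := by
  have hd0 : (0 : ℝ) < (2 * d : ℝ) ^ m := by
    have : (0:ℝ) < d := by exact_mod_cast hd
    positivity
  have hCp : 0 ≤ ∏ i, C i := Finset.prod_nonneg fun i _ => hC i
  have hw : ∀ x ∈ Fintype.piFinset S, ‖∏ i, c i (x i)‖ ≤ ∏ i, C i := by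
    intro x hx
    rw [norm_prod]
    exact Finset.prod_le_prod (fun i _ => norm_nonneg _)
      (fun i _ => hc i _ (Fintype.mem_piFinset.1 hx i))
  have hcount : ∑ x ∈ Fintype.piFinset S, (srwCount d m x : ℝ) ≤ (2 * d : ℝ) ^ m := by
    have hle : ∑ x ∈ Fintype.piFinset S, srwLaw d m x ≤ 1 :=
      sum_le_hasSum _ (fun x _ => srwLaw_nonneg m x) (hasSum_srwLaw hd m)
    have heq : ∀ x : Fin d → ℤ, (srwCount d m x : ℝ) = (2 * d : ℝ) ^ m * srwLaw d m x := by
      intro x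
      rw [srwLaw_eq_srwCount_div, mul_div_cancel₀ _ hd0.ne']
    simp_rw [heq, ← Finset.mul_sum]
    calc (2 * d : ℝ) ^ m * ∑ x ∈ Fintype.piFinset S, srwLaw d m x
        ≤ (2 * d : ℝ) ^ m * 1 := by gcongr
      _ = (2 * d : ℝ) ^ m := mul_one _
  calc ‖∑ x ∈ Fintype.piFinset S, (∏ i, c i (x i)) * (srwCount d m x : ℂ)‖
      ≤ ∑ x ∈ Fintype.piFinset S, ‖(∏ i, c i (x i)) * (srwCount d m x : ℂ)‖ := norm_sum_le _ _
    _ ≤ ∑ x ∈ Fintype.piFinset S, (∏ i, C i) * (srwCount d m x : ℝ) := by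
        refine Finset.sum_le_sum fun x hx => ?_
        rw [norm_mul, Complex.norm_natCast]
        gcongr
        exact hw x hx
    _ = (∏ i, C i) * ∑ x ∈ Fintype.piFinset S, (srwCount d m x : ℝ) := by rw [Finset.mul_sum]
    _ ≤ (∏ i, C i) * (2 * d : ℝ) ^ m := by gcongr

end Literature.Probability.FitznerVanDerHofstad2017
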